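import Literature.MathematicalPhysics.QuantumLattice.MerminWagnerCriterionEquilibriumStates
import Mathlib.NumberTheory.Harmonic.Bounds
import HarnessLib

/-!
# The Mermin–Wagner theorem for translation-invariant equilibrium states in two dimensions (Klein–Landau–Shucker)

Topic `Literature/MathematicalPhysics/QuantumLattice` (family `hubbard`; sequel of `MerminWagnerCriterionEquilibriumStates`, which reduces
the statement to the existence of slowly varying cutoffs).

**Klein–Landau–Shucker, J. Stat. Phys. 26 (1981) 505, Theorem** (for quantum lattice systems; Mermin–Wagner 1966, Hohenberg 1967 for
the finite-volume magnetisation; Fröhlich–Pfister 1981): *in two (or one) dimensions every equilibrium state of a finite-range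
interaction invariant under a continuous one-parameter group of internal symmetries generated by an on-site charge is invariant under
that group.* On local observables this says: `ω(O) = 0` for every local `O` of nonzero charge.

This file PROVES it for lattice fermions on `ℤ²` in the tree's formalism: for every Hermitian, even, translation-covariant interaction
`Ψ` of finite range `R` on `ℤ²` each of whose terms conserves an even Hermitian on-site charge `q` (`Q_Z Φ(Z) = Φ(Z) Q_Z`,
`Q_Z = Σ_{x∈Z} q_x`), every `β ≥ 0`, every translation-invariant state `ω` solving the variational principle
(`S(ω_{[0,n)²})/n² → P_free(β,Ψ) + β e_Ψ(ω)`; in particular every `IsVarEquilibrium β Ψ R` state) and every local `O ∈ 𝔄_Λ` with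
`Q_Λ O − O Q_Λ = κO`, `κ ≠ 0`:

* `InfVolFermionState.IsTranslationInvariant.expect_eq_zero_of_conservedCharge_two` — `ω(O) = 0`;
* `InfVolFermionState.IsVarEquilibrium.expect_eq_zero_of_conservedCharge_two` — the same for equilibrium states.

(For the Hubbard model: `q = n_↑ + n_↓` gives `ω(c_{xσ}) = ω(c_{x↑}c_{y↓}) = ω(Δ) = 0` for every pair field — no `U(1)` breaking,
hence no superconducting order parameter, in ANY translation-invariant equilibrium state at any temperature; `q = S^z` gives
`ω(S^±_x) = 0`.)

## Proof

By `IsTranslationInvariant.expect_eq_zero_of_conservedCharge` it suffices to produce, for every `ε > 0`, real weights `f ≡ 1` on `Λ`,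
`f ≡ 0` off a box, and a modulus `b` (`|f(x) − f(y)| ≤ b(x)` for `‖y − x‖_∞ ≤ R`) with `Σ_{x ∈ box} b(x)² ≤ ε`. §1: the logarithmic
cutoff `f(x) = clamp_{[0,1]}(1 − log(‖x‖_∞/a)/M)` (`a` beyond `Λ` and `3⌊R⌋`) is `1` on `‖x‖ ≤ a`, `0` for `‖x‖ ≥ ae^M`, and
`|f(x) − f(y)| ≤ 2⌊R⌋/(M‖x‖_∞)` for `‖y − x‖_∞ ≤ ⌊R⌋`, `‖x‖_∞ > a − ⌊R⌋` (`|log n − log m| ≤ |n − m|/min(n,m)`), and `0` closer in.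
§2: the shells of `ℤ²` have `8n` sites, so `Σ_{‖x‖ ≤ T} b(x)² ≤ (32⌊R⌋²/M²)(1 + log T)` (harmonic numbers), and with `T ≈ ae^M`,
`Σ b² ≲ 32⌊R⌋²(1 + log(a+⌊R⌋+1) + M)/M² → 0` as `M → ∞` — the two-dimensional `∫|∇f|² ~ 1/log` phenomenon. §3 assembles.
Everything is PROVED (standard axioms); one definition (`logCutoff`), no named fact.

## Mathlib / tree search

REUSED: `IsTranslationInvariant.expect_eq_zero_of_conservedCharge` (`MerminWagnerCriterionEquilibriumStates`), `box`, `sphere`,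
`Site.supNorm`, `mem_box_iff_supNorm_le`, `card_sphere_succ_add`, `card_box`, `mem_thicken_iff` (`Literature.Probability.LatticeModels`,
`QuantumLattice`); Mathlib `harmonic_le_one_add_log`, `abs_max_sub_max_le_max`, `abs_min_sub_min_le_max`, `Real.log_le_sub_one_of_pos`.

## References

* A. Klein, L. J. Landau, D. S. Shucker, *On the absence of spontaneous breakdown of continuous symmetry for equilibrium states in two
  dimensions*, J. Stat. Phys. 26 (1981) 505–512. [cite: KleinLandauShucker1981]
* N. D. Mermin, H. Wagner, Phys. Rev. Lett. 17 (1966) 1133; P. C. Hohenberg, Phys. Rev. 158 (1967) 383. [cite: MerminWagner1966]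
* J. Fröhlich, C. Pfister, Commun. Math. Phys. 81 (1981) 277. [cite: FrohlichPfister1981]
* H. Araki, H. Moriya, Rev. Math. Phys. 15 (2003) 93, Thm. 12.11. [cite: ArakiMoriya2003, Theorem 12.11]
-/

noncomputable section

open scoped ComplexOrder BigOperators Matrix.Norms.L2Operator
open Finset Literature.InformationTheory.Entropy

namespace Literature.MathematicalPhysics.QuantumLattice

open Matrix Literature.Probability.LatticeModels ThermodynamicLimit
open _root_.Filter
open scoped _root_.Topology

variable {d : ℕ}

/-! ### §1 The logarithmic cutoff and its modulus -/

/-- **The logarithmic Mermin–Wagner cutoff** `f(x) = clamp_{[0,1]}(1 − log(‖x‖_∞ / a)/M)`: `1` on the box of radius `a`, `0` outside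
radius `a e^M`, logarithmically interpolating in between. [cite: KleinLandauShucker1981] -/
def logCutoff (a : ℕ) (M : ℝ) (x : Site d) : ℝ :=
  min 1 (max 0 (1 - Real.log ((Site.supNorm x : ℝ) / a) / M))

section Cutoff

variable {a : ℕ} {M : ℝ}

/-- `0 ≤ f ≤ 1`. [cite: KleinLandauShucker1981] -/
theorem logCutoff_mem_Icc (a : ℕ) (M : ℝ) (x : Site d) : logCutoff a M x ∈ Set.Icc (0 : ℝ) 1 :=
  ⟨le_min zero_le_one (le_max_left _ _), min_le_left _ _⟩

/-- `f = 1` on the box of radius `a`. [cite: KleinLandauShucker1981] -/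
theorem logCutoff_eq_one (ha : 1 ≤ a) (hM : 0 < M) {x : Site d} (hx : Site.supNorm x ≤ a) : logCutoff a M x = 1 := by
  unfold logCutoff
  have hlog : Real.log ((Site.supNorm x : ℝ) / a) ≤ 0 := by
    rcases Nat.eq_zero_or_pos (Site.supNorm x) with h0 | hpos
    · rw [h0, Nat.cast_zero, zero_div, Real.log_zero]
    · apply Real.log_nonpos (by positivity)
      rw [div_le_one (by exact_mod_cast ha)]
      exact_mod_cast hx
  have h1 : 1 ≤ 1 - Real.log ((Site.supNorm x : ℝ) / a) / M := by
    have : Real.log ((Site.supNorm x : ℝ) / a) / M ≤ 0 := div_nonpos_of_nonpos_of_nonneg hlog hM.le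
    linarith
  rw [max_eq_right (le_trans zero_le_one h1), min_eq_left h1]

/-- `f = 0` outside radius `a e^M`. [cite: KleinLandauShucker1981] -/
theorem logCutoff_eq_zero (ha : 1 ≤ a) (hM : 0 < M) {x : Site d} (hx : (a : ℝ) * Real.exp M ≤ Site.supNorm x) :
    logCutoff a M x = 0 := by
  unfold logCutoff
  have ha' : (0 : ℝ) < a := by exact_mod_cast ha
  have hn : (0 : ℝ) < Site.supNorm x := lt_of_lt_of_le (by positivity) hx
  have hlog : M ≤ Real.log ((Site.supNorm x : ℝ) / a) := by
    rw [Real.le_log_iff_exp_le (by positivity), le_div_iff₀ ha']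
    linarith
  have h1 : 1 - Real.log ((Site.supNorm x : ℝ) / a) / M ≤ 0 := by
    have : 1 ≤ Real.log ((Site.supNorm x : ℝ) / a) / M := by rw [le_div_iff₀ hM, one_mul]; exact hlog
    linarith
  rw [max_eq_left h1, min_eq_right zero_le_one]

/-- The clamp is `1`-Lipschitz: `|f(x) − f(y)| ≤ |log ‖x‖ − log ‖y‖| / M` (both norms positive). [cite: KleinLandauShucker1981] -/
theorem abs_logCutoff_sub_le (ha : 1 ≤ a) (hM : 0 < M) {x y : Site d} (hx : 1 ≤ Site.supNorm x) (hy : 1 ≤ Site.supNorm y) :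
    |logCutoff a M x - logCutoff a M y| ≤ |Real.log (Site.supNorm x) - Real.log (Site.supNorm y)| / M := by
  unfold logCutoff
  have ha' : (a : ℝ) ≠ 0 := by exact_mod_cast (Nat.one_le_iff_ne_zero.1 ha)
  have hx' : (Site.supNorm x : ℝ) ≠ 0 := by exact_mod_cast (Nat.one_le_iff_ne_zero.1 hx)
  have hy' : (Site.supNorm y : ℝ) ≠ 0 := by exact_mod_cast (Nat.one_le_iff_ne_zero.1 hy)
  refine (abs_min_sub_min_le_max _ _ _ _).trans ?_
  rw [sub_self, abs_zero, max_eq_right (abs_nonneg _)]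
  refine (abs_max_sub_max_le_max _ _ _ _).trans ?_
  rw [sub_self, abs_zero, max_eq_right (abs_nonneg _), Real.log_div hx' ha', Real.log_div hy' ha']
  have e : 1 - (Real.log (Site.supNorm x) - Real.log a) / M - (1 - (Real.log (Site.supNorm y) - Real.log a) / M) =
      -((Real.log (Site.supNorm x) - Real.log (Site.supNorm y)) / M) := by ring
  rw [e, abs_neg, abs_div, abs_of_pos hM]

/-- `|log n − log m| ≤ |n − m| / min(n, m)` for positive reals. [folklore] -/
private theorem abs_log_sub_log_le {n m : ℝ} (hn : 0 < n) (hm : 0 < m) :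
    |Real.log n - Real.log m| ≤ |n - m| / min n m := by
  have h1 : Real.log n - Real.log m ≤ (n - m) / m := by
    rw [← Real.log_div hn.ne' hm.ne']
    have := Real.log_le_sub_one_of_pos (div_pos hn hm)
    rwa [div_sub_one hm.ne'] at this
  have h2 : Real.log m - Real.log n ≤ (m - n) / n := by
    rw [← Real.log_div hm.ne' hn.ne']
    have := Real.log_le_sub_one_of_pos (div_pos hm hn)
    rwa [div_sub_one hn.ne'] at this
  have hmin : 0 < min n m := lt_min hn hm
  rw [abs_le]
  constructor
  · -- `-(|n-m|/min) ≤ log n − log m`, i.e. `log m − log n ≤ |n − m|/min`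
    have : (m - n) / n ≤ |n - m| / min n m := by
      rcases le_or_gt n m with hnm | hnm
      · rw [min_eq_left hnm, abs_sub_comm, abs_of_nonneg (by linarith)]
      · have : (m - n) / n ≤ 0 := div_nonpos_of_nonpos_of_nonneg (by linarith) hn.le
        exact this.trans (div_nonneg (abs_nonneg _) hmin.le)
    linarith
  · have : (n - m) / m ≤ |n - m| / min n m := by
      rcases le_or_gt m n with hnm | hnm
      · rw [min_eq_right hnm, abs_of_nonneg (by linarith)]
      · have : (n - m) / m ≤ 0 := div_nonpos_of_nonpos_of_nonneg (by linarith) hm.le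
        exact this.trans (div_nonneg (abs_nonneg _) hmin.le)
    linarith

/-- **The modulus of the cutoff at range `r`**: `b(x) = 2r/(M‖x‖_∞)` beyond radius `a − r`, `0` inside. [cite: KleinLandauShucker1981] -/
def logCutoffModulus (a r : ℕ) (M : ℝ) (x : Site d) : ℝ :=
  if a - r < Site.supNorm x then 2 * r / (M * Site.supNorm x) else 0

/-- `b ≥ 0`. [cite: KleinLandauShucker1981] -/
theorem logCutoffModulus_nonneg (a r : ℕ) (hM : 0 < M) (x : Site d) : 0 ≤ logCutoffModulus a r M x := by
  unfold logCutoffModulus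
  split_ifs
  · positivity
  · exact le_rfl

/-- **`b` is a modulus for `f` at range `r`** when `a ≥ 3r`: `|f(x) − f(y)| ≤ b(x)` whenever `‖y − x‖_∞ ≤ r`. Inside radius `a − r`
both values are `1`; beyond, `‖x‖ ≥ 2r + 1`, `‖y‖ ≥ ‖x‖ − r ≥ ‖x‖/2` and `|log‖x‖ − log‖y‖| ≤ r/(‖x‖ − r) ≤ 2r/‖x‖`.
[cite: KleinLandauShucker1981] -/
theorem abs_logCutoff_sub_le_modulus (ha : 1 ≤ a) {r : ℕ} (har : 3 * r ≤ a) (hM : 0 < M) {x y : Site d}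
    (hxy : y - x ∈ box d r) : |logCutoff a M x - logCutoff a M y| ≤ logCutoffModulus a r M x := by
  have hdiff : Site.supNorm (y - x) ≤ r := mem_box_iff_supNorm_le.1 hxy
  -- `‖y‖ ≤ ‖x‖ + r` and `‖x‖ ≤ ‖y‖ + r`
  have hy_le : Site.supNorm y ≤ Site.supNorm x + r := by
    have h := Site.supNorm_add_le (y - x) x
    rw [sub_add_cancel] at h
    omega
  have hx_le : Site.supNorm x ≤ Site.supNorm y + r := by
    have h := Site.supNorm_add_le (x - y) y
    rw [sub_add_cancel, ← neg_sub, Site.supNorm_neg'] at h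
    omega
  unfold logCutoffModulus
  split_ifs with hfar
  · -- far region
    have hn1 : 1 ≤ Site.supNorm x := by omega
    have hm1 : 1 ≤ Site.supNorm y := by omega
    refine (abs_logCutoff_sub_le ha hM hn1 hm1).trans ?_
    have hn : (0 : ℝ) < Site.supNorm x := by exact_mod_cast hn1
    have hm : (0 : ℝ) < Site.supNorm y := by exact_mod_cast hm1
    have hlog := abs_log_sub_log_le hn hm
    -- `|n − m| ≤ r`, `min n m ≥ n − r ≥ n/2`
    have hnm : |(Site.supNorm x : ℝ) - Site.supNorm y| ≤ r := by
      rw [abs_le]; constructor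
      · have : (Site.supNorm y : ℝ) ≤ Site.supNorm x + r := by exact_mod_cast hy_le
        linarith
      · have : (Site.supNorm x : ℝ) ≤ Site.supNorm y + r := by exact_mod_cast hx_le
        linarith
    have hmin : (Site.supNorm x : ℝ) / 2 ≤ min (Site.supNorm x : ℝ) (Site.supNorm y) := by
      have h2r : (2 * r + 1 : ℝ) ≤ Site.supNorm x := by exact_mod_cast (by omega : 2 * r + 1 ≤ Site.supNorm x)
      have : (Site.supNorm x : ℝ) ≤ Site.supNorm y + r := by exact_mod_cast hx_le
      rw [le_min_iff]; constructor <;> linarith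
    have hmin0 : (0 : ℝ) < min (Site.supNorm x : ℝ) (Site.supNorm y) := lt_min hn hm
    calc |Real.log (Site.supNorm x) - Real.log (Site.supNorm y)| / M
        ≤ (|(Site.supNorm x : ℝ) - Site.supNorm y| / min (Site.supNorm x : ℝ) (Site.supNorm y)) / M :=
          div_le_div_of_nonneg_right hlog hM.le
      _ ≤ ((r : ℝ) / ((Site.supNorm x : ℝ) / 2)) / M := by
          refine div_le_div_of_nonneg_right ?_ hM.le
          calc |(Site.supNorm x : ℝ) - Site.supNorm y| / min (Site.supNorm x : ℝ) (Site.supNorm y)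
              ≤ (r : ℝ) / min (Site.supNorm x : ℝ) (Site.supNorm y) := div_le_div_of_nonneg_right hnm hmin0.le
            _ ≤ (r : ℝ) / ((Site.supNorm x : ℝ) / 2) := div_le_div_of_nonneg_left (Nat.cast_nonneg _) (by positivity) hmin
      _ = 2 * r / (M * Site.supNorm x) := by
          field_simp
  · -- near region: both values are `1`
    have hxa : Site.supNorm x ≤ a := by omega
    have hya : Site.supNorm y ≤ a := by omega
    rw [logCutoff_eq_one ha hM hxa, logCutoff_eq_one ha hM hya, sub_self, abs_zero]

end Cutoff

/-! ### §2 The two-dimensional shell sum: `Σ_{‖x‖ ≤ T} b(x)² ≤ 32 r² (1 + log T)/M²` -/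

section Shells

/-- The shells of `ℤ²`: `|∂Λ_{k+1}| = 8(k+1)`. [cite: FriedliVelenik2017, §3.2 (the boxes B(n))] -/
private theorem card_sphere_two_succ' (k : ℕ) : #(sphere 2 (k + 1)) = 8 * (k + 1) := by
  have h := card_sphere_succ_add (d := 2) k
  rw [card_box, card_box] at h
  have e : (2 * (k + 1) + 1) ^ 2 = 8 * (k + 1) + (2 * k + 1) ^ 2 := by ring
  rw [e] at h
  exact Nat.add_right_cancel h

/-- `|∂Λ_n| ≤ 8n` for `n ≥ 1` and `|∂Λ_0| = 1`; in all cases `|∂Λ_n| · n⁻² ≤ 8 · n⁻¹` (with `0⁻¹ = 0`... the origin shell is handled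
separately by the vanishing of the modulus there). [folklore] -/
private theorem card_sphere_two_le (n : ℕ) (hn : 1 ≤ n) : (#(sphere 2 n) : ℝ) ≤ 8 * n := by
  obtain ⟨k, rfl⟩ := Nat.exists_eq_add_of_le' hn
  rw [card_sphere_two_succ']
  push_cast
  exact le_rfl

/-- A box is the disjoint union of its shells: `Σ_{‖x‖ ≤ T} F(x) = Σ_{n ≤ T} Σ_{‖x‖ = n} F(x)`. [folklore] -/
private theorem sum_box_eq_sum_sphere' (F : Site d → ℝ) (T : ℕ) :
    ∑ x ∈ box d T, F x = ∑ n ∈ Finset.range (T + 1), ∑ x ∈ sphere d n, F x := by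
  rw [← Finset.sum_fiberwise_of_maps_to (g := Site.supNorm) (t := Finset.range (T + 1))
    (fun x hx => Finset.mem_range.2 (Nat.lt_succ_of_le (mem_box_iff_supNorm_le.1 hx)))]
  refine Finset.sum_congr rfl fun m hm => Finset.sum_congr ?_ fun _ _ => rfl
  ext x
  simp only [Finset.mem_filter, mem_box_iff_supNorm_le, mem_sphere]
  constructor
  · rintro ⟨-, h⟩; exact h
  · intro h; exact ⟨by rw [h]; exact Nat.lt_succ_iff.1 (Finset.mem_range.1 hm), h⟩

/-- `Σ_{n ≤ T} n⁻¹ ≤ 1 + log T` (harmonic numbers; the `n = 0` term is `0⁻¹ = 0`). [folklore] -/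
private theorem sum_range_inv_le_one_add_log (T : ℕ) :
    ∑ n ∈ Finset.range (T + 1), ((n : ℝ))⁻¹ ≤ 1 + Real.log T := by
  rw [Finset.sum_range_succ', Nat.cast_zero, _root_.inv_zero, add_zero]
  have h := harmonic_le_one_add_log T
  have e : ((harmonic T : ℚ) : ℝ) = ∑ n ∈ Finset.range T, (((n + 1 : ℕ) : ℝ))⁻¹ := by
    rw [harmonic]; push_cast; rfl
  rw [e] at h
  exact h

/-- **THE TWO-DIMENSIONAL DIRICHLET SUM OF THE LOGARITHMIC CUTOFF**: `Σ_{‖x‖_∞ ≤ T} b(x)² ≤ 32 r²(1 + log T)/M²`.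
[cite: KleinLandauShucker1981] -/
theorem sum_box_logCutoffModulus_sq_le (a r : ℕ) {M : ℝ} (hM : 0 < M) (T : ℕ) :
    ∑ x ∈ box 2 T, logCutoffModulus a r M x ^ 2 ≤ 32 * (r : ℝ) ^ 2 * (1 + Real.log T) / M ^ 2 := by
  rw [sum_box_eq_sum_sphere']
  -- shell by shell: `Σ_{‖x‖ = n} b² ≤ 8n · (2r/(Mn))² = (32 r²/M²) · n⁻¹`
  have hshell : ∀ n ∈ Finset.range (T + 1), ∑ x ∈ sphere 2 n, logCutoffModulus a r M x ^ 2 ≤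
      32 * (r : ℝ) ^ 2 / M ^ 2 * ((n : ℝ))⁻¹ := by
    intro n _
    rcases Nat.eq_zero_or_pos n with h0 | hpos
    · -- the origin: `b(0) = 0` unless `a - r < 0`, impossible
      subst h0
      have h : ∀ x ∈ sphere 2 0, logCutoffModulus a r M x ^ 2 = 0 := fun x hx => by
        rw [logCutoffModulus, mem_sphere.1 hx, if_neg (Nat.not_lt_zero _), zero_pow two_ne_zero]
      rw [Finset.sum_congr rfl h, Finset.sum_const_zero, Nat.cast_zero, _root_.inv_zero, mul_zero]
    · have hle : ∀ x ∈ sphere 2 n, logCutoffModulus a r M x ^ 2 ≤ (2 * r / (M * n)) ^ 2 := fun x hx => by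
        rw [logCutoffModulus, mem_sphere.1 hx]
        split_ifs
        · exact le_rfl
        · rw [zero_pow two_ne_zero]; positivity
      refine (Finset.sum_le_sum hle).trans ?_
      rw [Finset.sum_const, nsmul_eq_mul]
      have hn : (0 : ℝ) < n := by exact_mod_cast hpos
      calc (#(sphere 2 n) : ℝ) * (2 * r / (M * n)) ^ 2 ≤ 8 * n * (2 * r / (M * n)) ^ 2 :=
            mul_le_mul_of_nonneg_right (card_sphere_two_le n hpos) (sq_nonneg _)
        _ = 32 * (r : ℝ) ^ 2 / M ^ 2 * ((n : ℝ))⁻¹ := by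
            field_simp
            ring
  refine (Finset.sum_le_sum hshell).trans ?_
  rw [← Finset.mul_sum]
  have hH := sum_range_inv_le_one_add_log T
  have hc : 0 ≤ 32 * (r : ℝ) ^ 2 / M ^ 2 := by positivity
  calc 32 * (r : ℝ) ^ 2 / M ^ 2 * ∑ n ∈ Finset.range (T + 1), ((n : ℝ))⁻¹ ≤ 32 * (r : ℝ) ^ 2 / M ^ 2 * (1 + Real.log T) :=
        mul_le_mul_of_nonneg_left hH hc
    _ = 32 * (r : ℝ) ^ 2 * (1 + Real.log T) / M ^ 2 := by ring

/-- `thicken (box N) R ⊆ box (N + ⌊R⌋)`. [cite: BratteliRobinsonII1997, §6.2.1] -/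
theorem thicken_box_subset (N : ℕ) (R : ℝ) : thicken (box d N) R ⊆ box d (N + ⌊R⌋₊) := by
  intro z hz
  obtain ⟨s, hs, w, hw, rfl⟩ := mem_thicken_iff.1 hz
  rw [mem_box_iff_supNorm_le] at hs hw ⊢
  exact (Site.supNorm_add_le s w).trans (add_le_add hs hw)

end Shells

/-! ### §3 The theorem -/

section CutoffData

/-- **The cutoff data in two dimensions**: for every finite `Λ ⊂ ℤ²`, every range and every `ε > 0` there are a box `Λ₁ ⊇ Λ`, weights
`f ≡ 1` on `Λ`, `f ≡ 0` off `Λ₁`, and a modulus `b` at range `⌊R⌋` with `K · Σ_{x ∈ thicken Λ₁ R} b(x)² ≤ ε` for any prescribed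
constant `K ≥ 0`. [cite: KleinLandauShucker1981] -/
theorem exists_logCutoff_data (Λ : Finset (Site 2)) (R : ℝ) {K : ℝ} (hK : 0 ≤ K) {ε : ℝ} (hε : 0 < ε) :
    ∃ (Λ₁ : Finset (Site 2)) (_ : Λ ⊆ Λ₁) (f b : Site 2 → ℝ),
      (∀ x ∈ Λ, f x = 1) ∧ (∀ x ∉ Λ₁, f x = 0) ∧ (∀ x y : Site 2, y - x ∈ box 2 ⌊R⌋₊ → |f x - f y| ≤ b x) ∧
      K * ∑ x ∈ thicken Λ₁ R, b x ^ 2 ≤ ε := by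
  classical
  set r : ℕ := ⌊R⌋₊ with hr
  -- a box containing `Λ`
  obtain ⟨ρ₀, hρ₀⟩ : ∃ ρ₀ : ℕ, ∀ x ∈ Λ, Site.supNorm x ≤ ρ₀ :=
    ⟨Λ.sup Site.supNorm, fun x hx => Finset.le_sup hx⟩
  set a : ℕ := ρ₀ + 3 * r + 1 with ha
  have ha1 : 1 ≤ a := by omega
  have har : 3 * r ≤ a := by omega
  set L : ℝ := Real.log ((a : ℝ) + r + 1) with hL
  have hL0 : 0 ≤ L := Real.log_nonneg (by have : (1 : ℝ) ≤ a := by exact_mod_cast ha1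
                                          have : (0 : ℝ) ≤ r := Nat.cast_nonneg _
                                          linarith)
  -- the scale `M ≥ 1` with `K · 32 r² (2 + L) / M ≤ ε`
  set M : ℝ := max 1 (K * (32 * (r : ℝ) ^ 2 * (2 + L)) / ε) with hM
  have hM1 : 1 ≤ M := le_max_left _ _
  have hM0 : 0 < M := lt_of_lt_of_le one_pos hM1
  have hMε : K * (32 * (r : ℝ) ^ 2 * (2 + L)) / M ≤ ε := by
    rw [div_le_iff₀ hM0]
    have h := le_max_right 1 (K * (32 * (r : ℝ) ^ 2 * (2 + L)) / ε)
    rw [← hM, div_le_iff₀ hε] at h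
    linarith [mul_comm ε M]
  -- the outer box
  set N : ℕ := ⌈(a : ℝ) * Real.exp M⌉₊ with hN
  have haN : a ≤ N := by
    have h1 : (a : ℝ) ≤ (a : ℝ) * Real.exp M := le_mul_of_one_le_right (Nat.cast_nonneg _) (Real.one_le_exp hM0.le)
    exact_mod_cast h1.trans (Nat.le_ceil _)
  refine ⟨box 2 N, fun x hx => mem_box_iff_supNorm_le.2 ((hρ₀ x hx).trans (by omega)), logCutoff a M, logCutoffModulus a r M,
    fun x hx => logCutoff_eq_one ha1 hM0 ((hρ₀ x hx).trans (by omega)), fun x hx => ?_,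
    fun x y hxy => abs_logCutoff_sub_le_modulus ha1 har hM0 hxy, ?_⟩
  · -- `f = 0` off the box: `‖x‖ ≥ N + 1 > a e^M`
    refine logCutoff_eq_zero ha1 hM0 ?_
    rw [mem_box_iff_supNorm_le, not_le] at hx
    have h1 : ((N : ℕ) : ℝ) + 1 ≤ Site.supNorm x := by exact_mod_cast hx
    have h2 : (a : ℝ) * Real.exp M ≤ N := Nat.le_ceil _
    linarith
  · -- the Dirichlet sum
    have hsub : thicken (box 2 N) R ⊆ box 2 (N + r) := thicken_box_subset N R
    have hT1 : 1 ≤ N + r := by omega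
    have h1 : ∑ x ∈ thicken (box 2 N) R, logCutoffModulus a r M x ^ 2 ≤ ∑ x ∈ box 2 (N + r), logCutoffModulus a r M x ^ 2 :=
      Finset.sum_le_sum_of_subset_of_nonneg hsub fun x _ _ => sq_nonneg _
    have h2 := sum_box_logCutoffModulus_sq_le a r hM0 (N + r)
    -- `log (N + r) ≤ L + M`
    have h3 : Real.log ((N + r : ℕ) : ℝ) ≤ L + M := by
      have hNr : ((N + r : ℕ) : ℝ) ≤ ((a : ℝ) + r + 1) * Real.exp M := by
        push_cast
        have hc : (N : ℝ) < (a : ℝ) * Real.exp M + 1 := Nat.ceil_lt_add_one (by positivity)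
        have he : 1 ≤ Real.exp M := Real.one_le_exp hM0.le
        have hr0 : (0 : ℝ) ≤ r := Nat.cast_nonneg _
        nlinarith
      have hpos : (0 : ℝ) < ((N + r : ℕ) : ℝ) := by exact_mod_cast hT1
      calc Real.log ((N + r : ℕ) : ℝ) ≤ Real.log (((a : ℝ) + r + 1) * Real.exp M) := Real.log_le_log hpos hNr
        _ = L + M := by rw [Real.log_mul (by positivity) (Real.exp_pos M).ne', Real.log_exp]
    have h4 : ∑ x ∈ thicken (box 2 N) R, logCutoffModulus a r M x ^ 2 ≤ 32 * (r : ℝ) ^ 2 * (1 + (L + M)) / M ^ 2 := by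
      refine h1.trans (h2.trans ?_)
      exact div_le_div_of_nonneg_right (mul_le_mul_of_nonneg_left (by linarith) (by positivity)) (sq_nonneg _)
    -- `1 + L + M ≤ (2 + L) M`
    have h5 : 32 * (r : ℝ) ^ 2 * (1 + (L + M)) / M ^ 2 ≤ 32 * (r : ℝ) ^ 2 * (2 + L) / M := by
      rw [div_le_div_iff₀ (by positivity) hM0]
      have hprod : 0 ≤ M * ((1 + L) * (M - 1)) := mul_nonneg hM0.le (mul_nonneg (by linarith) (by linarith))
      have e : (2 + L) * M ^ 2 - (1 + (L + M)) * M = M * ((1 + L) * (M - 1)) := by ring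
      have h6 : (1 + (L + M)) * M ≤ (2 + L) * M ^ 2 := by linarith
      have h7 := mul_le_mul_of_nonneg_left h6 (by positivity : (0 : ℝ) ≤ 32 * (r : ℝ) ^ 2)
      linarith
    calc K * ∑ x ∈ thicken (box 2 N) R, logCutoffModulus a r M x ^ 2 ≤ K * (32 * (r : ℝ) ^ 2 * (2 + L) / M) :=
          mul_le_mul_of_nonneg_left (h4.trans h5) hK
      _ = K * (32 * (r : ℝ) ^ 2 * (2 + L)) / M := by ring
      _ ≤ ε := hMε

end CutoffData

section MerminWagner

variable {Ψ : FermionInteraction 2} {R : ℝ} (hH : Ψ.IsHermitian) (hE : Ψ.IsEven)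
  (hT : Ψ.IsTranslationInvariant) (hR : Ψ.HasFiniteRange R) {β : ℝ} (hβ : 0 ≤ β) {ω : InfVolFermionState 2}
include hH hE hT hR hβ

/-- **MERMIN–WAGNER FOR EQUILIBRIUM STATES IN TWO DIMENSIONS (Klein–Landau–Shucker), variational-principle form.** Let `Ψ` be a
Hermitian, even, translation-covariant interaction of finite range `R` on `ℤ²` each of whose terms conserves the even Hermitian
on-site charge `q` (`Q_Z Φ(Z) = Φ(Z) Q_Z`). Let `β ≥ 0` and `ω` be a translation-invariant state solving the variational principle
`S(ω_{[0,n)²})/n² → P_free(β,Ψ) + β e_Ψ(ω)`. Then `ω(O) = 0` for every local `O ∈ 𝔄_Λ` of nonzero charge (`Q_Λ O − O Q_Λ = κO`,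
`κ ≠ 0`): no translation-invariant equilibrium state breaks the continuous symmetry generated by `q`.
[cite: KleinLandauShucker1981] [cite: ArakiMoriya2003, Theorem 12.11] -/
theorem InfVolFermionState.IsTranslationInvariant.expect_eq_zero_of_conservedCharge_two (hω : ω.IsTranslationInvariant)
    (hS : Tendsto (fun n : ℕ => vonNeumannEntropy (ω.rdm (halfOpenBox 2 n)) / ((n : ℝ) ^ 2)) atTop
      (𝓝 (Ψ.freePressure β + β * ω.meanEnergy Ψ R)))
    {q : FermionOp ({0} : Finset (Site 2))} (hq : q.IsHermitian) (hqe : parityAut q = q)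
    (hcons : ∀ Z : Finset (Site 2), Commute (chargeSum q Z) (Ψ.Φ Z))
    {Λ : Finset (Site 2)} (O : FermionOp Λ) {κ : ℂ} (hκ : κ ≠ 0) (hO : chargeSum q Λ * O - O * chargeSum q Λ = κ • O) :
    ω.expect Λ O = 0 := by
  refine hω.expect_eq_zero_of_conservedCharge two_pos hH hE hT hR hβ hS hq hqe hcons O hκ hO fun ε hε => ?_
  obtain ⟨Λ₁, h₁, f, b, hf1, hf0, hb, hsum⟩ := exists_logCutoff_data Λ R
    (K := 4 * ‖q‖ ^ 2 * (((box 2 ⌊R⌋₊).card : ℝ) *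
      ∑ X ∈ (thicken ({0} : Finset (Site 2)) R).powerset with (0 : Site 2) ∈ X, ‖Ψ.Φ X‖)) (by positivity) hε
  refine ⟨Λ₁, h₁, f, b, hf1, hf0, hb, ?_⟩
  calc _ = 4 * ‖q‖ ^ 2 * (((box 2 ⌊R⌋₊).card : ℝ) *
        ∑ X ∈ (thicken ({0} : Finset (Site 2)) R).powerset with (0 : Site 2) ∈ X, ‖Ψ.Φ X‖) * ∑ x ∈ thicken Λ₁ R, b x ^ 2 := by ring
    _ ≤ ε := hsum

/-- **MERMIN–WAGNER FOR EQUILIBRIUM STATES IN TWO DIMENSIONS, equilibrium-state form**: every translation-invariant equilibrium state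
(`IsVarEquilibrium β Ψ R`, `β ≥ 0`) of a charge-conserving even finite-range interaction on `ℤ²` annihilates every local observable of
nonzero charge. [cite: KleinLandauShucker1981] [cite: ArakiMoriya2003, Theorem 12.11] -/
theorem InfVolFermionState.IsVarEquilibrium.expect_eq_zero_of_conservedCharge_two (h : ω.IsVarEquilibrium β Ψ R)
    {q : FermionOp ({0} : Finset (Site 2))} (hq : q.IsHermitian) (hqe : parityAut q = q)
    (hcons : ∀ Z : Finset (Site 2), Commute (chargeSum q Z) (Ψ.Φ Z))
    {Λ : Finset (Site 2)} (O : FermionOp Λ) {κ : ℂ} (hκ : κ ≠ 0) (hO : chargeSum q Λ * O - O * chargeSum q Λ = κ • O) :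
    ω.expect Λ O = 0 :=
  h.1.expect_eq_zero_of_conservedCharge_two hH hE hT hR hβ (h.tendsto_boxEntropy_div two_pos hH hE hT hR hβ) hq hqe hcons O hκ hO

end MerminWagner

end Literature.MathematicalPhysics.QuantumLattice

end
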